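import Summits.Ventures.HSemireg.WedgeHankelRecurrenceGaussSturmCount

/-!
# Venture HSemireg — **QUASI-ORTHOGONAL POLYNOMIALS AND THE RULE THROUGH A PRESCRIBED NODE**: `q_{n+2} − c q_{n+1}` (`c` real) is the `(n+2)`-nd member of the positive recurrence with
# `a_{n+1}` replaced by `a_{n+1} + c`, so it has `n + 2` simple real zeros interlaced by those of `q_{n+1}`; choosing `c = q_{n+2}(ξ)/q_{n+1}(ξ)` puts a zero AT `ξ`; the rule on these zeros
# with Christoffel weights is exact in degree `≤ 2n + 2` with positive weights (M. Riesz ∕ Shohat) — hence the CHEBYSHEV–MARKOV–STIELTJES INEQUALITIES AT AN ARBITRARY REAL `ξ`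

HONEST FRAMING. Part of the Lean index of the computation cell `pub-hsemireg` (seat p10 gen 43, Sunday typer «UNIFORM-IN-n»).  Real polynomials and finite sums only; no variety, no cohomology
theory, no sheaf, no Ext group and no semiregularity map is constructed here; nothing here says that HC / HC_CM / HC_AV holds; no Literature fact (unproved `Prop`) is declared or used.  Custodian
versions as in `WedgeHankelSiegelIdeal` (1/3).
SOURCES (cited).  M. Riesz, *Sur le problème des moments* III, Ark. Mat. Astr. Fys. 17 (1923) no. 16 (quasi-orthogonal polynomials); J. A. Shohat, *On mechanical quadratures, in particular, with
positive coefficients*, Trans. AMS 42 (1937) 461–496, §§2–3 (a rule on the zeros of `q_{n+1} − c q_n` is exact in degree `2n` with positive weights); T. S. Chihara, *An Introduction to Orthogonal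
Polynomials* (1978), Ch. I §5 Ex. 5.4–5.5 and Ch. II Thm 5.1–5.3; G. Szegő, *Orthogonal Polynomials*, Thm 3.3.4 (footnote) and §3.411 (Markov–Stieltjes at an arbitrary point); N. I.
Akhiezer, *The Classical Moment Problem*, Ch. I §4 (quasi-orthogonal polynomials, canonical representations); M. G. Krein, A. A. Nudel'man, *The Markov Moment Problem*, Ch. III §2.
PROOF TYPED HERE.  `q_{n+2} − c q_{n+1} = (X − a_{n+1} − c) q_{n+1} − b_{n+1} q_n` is N292 `recurrence_modify_top` with `(a′, b′) = (a_{n+1} + c, b_{n+1})`, so N279 `recurrence_zeros_interlace`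
gives the zeros; exactness in degree `2t` from orthogonality to degree `< t` is N265's division argument with the quotient either `0` or of degree `< t`; positivity of the weights is N265
`gauss_weight_pos` (which needs exactness only to degree `2t`); the inequalities at `ξ` are N271 `chebyshev_markov_stieltjes` applied to the rule having `ξ` as a node (the Gauss rule itself when
`q_{n+1}(ξ) = 0`).  The global positive recurrence of the orthogonal polynomials of a positive discrete measure (N273 spliced, as inside N291) is packaged as `exists_positive_recurrence_of_orthogonal`.
DEDUP DISCLOSURE (`rg -n 'quasiOrthogonal|quasi_gauss|sum_mul_eval_eq_of_orthogonal_lt|exists_positive_recurrence_of_orthogonal|stieltjes_through' Summits Literature`, 2026-09-03): N265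
`sum_mul_eval_eq_of_orthogonal` is the degree-`2t+1` version (orthogonality to degree `≤ t`); N271 `chebyshev_markov_stieltjes` is at the GAUSS nodes only; N276 `gauss_radau` fixes an END
point `c` below the support (a different construction, via the measure `(V − c) dM`).  The 8 names below: 0 hits tree-wide.

WHAT IS IN THE TREE.  N265 `sum_mul_eval_eq_sum_eval_mul_sum_basis`, `sum_mul_eval_eq_of_orthogonal`, `gauss_weight_pos`; N271 `chebyshev_markov_stieltjes`; N273 `three_term_recurrence`; N279
`recurrence_zeros_interlace`, `recurrence_zeros`, `eq_prod_X_sub_C_of_monic_of_roots`; N289 `exists_orthogonal_system_lower`; N292 `exists_recurrence_solution`, `recurrence_modify_top`; Mathlib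
`Polynomial.modByMonic_add_div`, `Polynomial.divByMonic_eq_zero_iff`, `Polynomial.natDegree_divByMonic`, `Lagrange.basis`.
THIS FILE (namespace `Summit.Ventures.HSemireg.Wedge.HankelOuter` continued; CHAINED on N294 (import), N292, N265, N271, N273, N279, N289; 0 definitions):
* §1060 `sum_mul_eval_eq_of_orthogonal_lt` (node polynomial orthogonal to degree `< t` ⇒ the interpolatory rule is exact in degree `≤ 2t`), `exists_positive_recurrence_of_orthogonal` (the orthogonal
  polynomials `q_0, …, q_n` of a positive discrete measure sit in a global positive recurrence), `quasiOrthogonal_recurrence` (`q_{n+2} − c q_{n+1}` is the `(n+2)`-nd member of the recurrence with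
  `a_{n+1} ↦ a_{n+1} + c`), **`quasiOrthogonal_zeros_interlace`** (its `n + 2` zeros are real, simple, interlaced by those of `q_{n+1}`), **`quasiOrthogonal_through`** (`c = q_{n+2}(ξ)/q_{n+1}(ξ)`:
  a zero at `ξ`), `quasi_gauss_exact` (SHOHAT: the rule on its zeros with Christoffel weights is exact in degree `≤ 2n + 2`), **`quasi_gauss_rule_through`** (for `q_{n+1}(ξ) ≠ 0`: a positive rule
  with `n + 2` nodes, one of them `ξ`, exact in degree `≤ 2n + 2`), **`chebyshev_markov_stieltjes_through`** (for EVERY real `ξ` and every positive discrete measure with `N > n + 2` atoms: a positive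
  rule with `t + 1 ∈ {n + 1, n + 2}` nodes `x_0 < ⋯ < x_t`, `x_i = ξ`, exact in degree `≤ 2t`, and `Σ_{j<i} λ_j ≤ ν(w < ξ) ≤ ν(w ≤ ξ) ≤ Σ_{j≤i} λ_j`).
CAVEATS.  The measure is positive and discrete with finitely many atoms, as throughout the chapter.  Nothing Ext-side.  New names only.
-/

open Module Polynomial
open scoped Matrix Polynomial

namespace Summit.Ventures.HSemireg.Wedge.HankelOuter

/-! ## §1060. Quasi-orthogonal polynomials; the rule through a prescribed node; Chebyshev–Markov–Stieltjes at an arbitrary point -/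

/-- **Exactness in degree `2t` from orthogonality to degree `< t`**: if the node polynomial `∏_j (X − v_j)` (`t + 1` distinct nodes) is `(ν, w)`-orthogonal to every `G` with `deg G < t` and the
weights are the Christoffel numbers `λ_k = Σ_l ν_l ℓ_k(w_l)`, then `Σ_j λ_j F(v_j) = Σ_l ν_l F(w_l)` for every `F` of degree `≤ 2t`. [Shohat 1937 §2; Chihara II Thm 5.1; this file, §1060] -/
theorem sum_mul_eval_eq_of_orthogonal_lt {t N : ℕ} {μ v : Fin (t + 1) → ℝ} {ν w : Fin N → ℝ} (hv : Function.Injective v)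
    (horth : ∀ G : ℝ[X], G.natDegree < t → ∑ l, ν l * ((∏ j, (Polynomial.X - C (v j))) * G).eval (w l) = 0)
    (hμ : ∀ k, μ k = ∑ l, ν l * (Lagrange.basis Finset.univ v k).eval (w l)) {F : ℝ[X]} (hF : F.natDegree ≤ 2 * t) :
    ∑ j, μ j * F.eval (v j) = ∑ l, ν l * F.eval (w l) := by
  set P : ℝ[X] := ∏ j, (Polynomial.X - C (v j)) with hP
  have hPm : P.Monic := monic_prod_of_monic _ _ fun j _ => monic_X_sub_C (v j)
  have hPdeg : P.natDegree = t + 1 := by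
    rw [hP, natDegree_prod_of_monic _ _ fun j _ => monic_X_sub_C (v j)]
    simp only [natDegree_X_sub_C, Finset.sum_const, Finset.card_univ, Fintype.card_fin, smul_eq_mul, mul_one]
  -- division with remainder
  have hdiv : F %ₘ P + P * (F /ₘ P) = F := modByMonic_add_div F P
  have hP1 : P ≠ 1 := fun h1 => by rw [h1, natDegree_one] at hPdeg; omega
  have hRdeg : (F %ₘ P).natDegree ≤ t := by
    have := natDegree_modByMonic_lt F hPm hP1
    rw [hPdeg] at this; omega
  -- the quotient term vanishes: either the quotient is `0` or its degree is `< t`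
  have hquot : ∑ l, ν l * (P * (F /ₘ P)).eval (w l) = 0 := by
    by_cases h0 : F /ₘ P = 0
    · simp [h0]
    · refine horth _ ?_
      have hle : P.degree ≤ F.degree := by
        by_contra hlt
        exact h0 ((divByMonic_eq_zero_iff hPm).2 (not_le.1 hlt))
      have hFnat : t + 1 ≤ F.natDegree := by rw [← hPdeg]; exact natDegree_le_natDegree hle
      rw [natDegree_divByMonic F hPm, hPdeg]; omega
  have hP0 : ∀ j, P.eval (v j) = 0 := fun j => by
    rw [hP, eval_prod]; exact Finset.prod_eq_zero (Finset.mem_univ j) (by simp)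
  have hsmall : ∑ j, μ j * F.eval (v j) = ∑ j, μ j * (F %ₘ P).eval (v j) := by
    refine Finset.sum_congr rfl fun j _ => ?_
    conv_lhs => rw [← hdiv]
    rw [eval_add, eval_mul, hP0 j, zero_mul, add_zero]
  have hbig : ∑ l, ν l * F.eval (w l) = ∑ l, ν l * (F %ₘ P).eval (w l) := by
    have h1 : ∑ l, ν l * F.eval (w l) = ∑ l, ν l * (F %ₘ P).eval (w l) + ∑ l, ν l * (P * (F /ₘ P)).eval (w l) := by
      rw [← Finset.sum_add_distrib]
      refine Finset.sum_congr rfl fun l _ => ?_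
      conv_lhs => rw [← hdiv]
      rw [eval_add]; ring
    rw [h1, hquot, add_zero]
  rw [hsmall, hbig, sum_mul_eval_eq_sum_eval_mul_sum_basis hv ν w hRdeg]
  rw [show ∑ j, μ j * (F %ₘ P).eval (v j) = ∑ j, (F %ₘ P).eval (v j) * μ j from Finset.sum_congr rfl fun j _ => mul_comm _ _]
  exact Finset.sum_congr rfl fun k _ => by rw [hμ k]

/-- **The orthogonal polynomials of a positive discrete measure sit in a global positive recurrence**: if `q_0 = 1, …, q_n` (`n < N`) are monic of the right degrees and `(ν, w)`-orthogonal to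
every lower degree (`ν > 0`, `w` injective on `Fin N`), there are `a`, `b > 0` and `Q : ℕ → ℝ[X]` with `Q_0 = 1`, `Q_1 = X − a_0`, `Q_{k+2} = (X − a_{k+1}) Q_{k+1} − b_{k+1} Q_k` and `Q_k = q_k` for
all `k ≤ n` (N273 spliced; tail coefficients `b = 1`). [Szegő Thm 3.2.1; Chihara I Thm 4.1; this file, §1060] -/
theorem exists_positive_recurrence_of_orthogonal {N n : ℕ} {ν w : Fin N → ℝ} (hν : ∀ l, 0 < ν l) (hw : Function.Injective w) (hnN : n < N)
    {q : ℕ → ℝ[X]} (hq0 : q 0 = 1) (hmonic : ∀ k, k ≤ n → (q k).Monic) (hdeg : ∀ k, k ≤ n → (q k).natDegree = k)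
    (horth : ∀ k, k ≤ n → ∀ G : ℝ[X], G.natDegree < k → ∑ l, ν l * (q k * G).eval (w l) = 0) :
    ∃ (a b : ℕ → ℝ) (Q : ℕ → ℝ[X]), Q 0 = 1 ∧ Q 1 = Polynomial.X - C (a 0) ∧
      (∀ k, Q (k + 2) = (Polynomial.X - C (a (k + 1))) * Q (k + 1) - C (b (k + 1)) * Q k) ∧ (∀ j, 0 < b j) ∧ ∀ k, k ≤ n → Q k = q k := by
  -- local recurrence coefficients from N273
  have hstep : ∀ m', 1 ≤ m' → m' + 1 ≤ n → ∃ a b : ℝ, q (m' + 1) = (Polynomial.X - C a) * q m' - C b * q (m' - 1) ∧ 0 < b := fun m' h1 h2 => by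
    obtain ⟨a, b, hrec, hb, -, -⟩ := three_term_recurrence hν hw h1 (by omega) (hmonic (m' - 1) (by omega)) (hdeg (m' - 1) (by omega)) (hmonic m' (by omega)) (hdeg m' (by omega))
      (hmonic (m' + 1) h2) (hdeg (m' + 1) h2) (horth (m' - 1) (by omega)) (horth m' (by omega)) (horth (m' + 1) h2)
    exact ⟨a, b, hrec, hb⟩
  choose! A B hAB hBpos using hstep
  set a' : ℕ → ℝ := fun k => if k = 0 then -(q 1).coeff 0 else A k with ha'
  set b' : ℕ → ℝ := fun k => if 1 ≤ k ∧ k + 1 ≤ n then B k else 1 with hb'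
  have hb'pos : ∀ j, 0 < b' j := fun j => by
    simp only [hb']
    split_ifs with h
    · exact hBpos j h.1 h.2
    · exact one_pos
  obtain ⟨Q, hQ0, hQ1, hQrec⟩ := exists_recurrence_solution a' b' 1 (Polynomial.X - C (a' 0))
  refine ⟨a', b', Q, hQ0, hQ1, hQrec, hb'pos, ?_⟩
  have hq1 : 1 ≤ n → q 1 = Polynomial.X - C (a' 0) := fun hn1 => by
    have h0 : a' 0 = -(q 1).coeff 0 := by simp [ha']
    rw [h0, C_neg, sub_neg_eq_add]
    exact (hmonic 1 hn1).eq_X_add_C (hdeg 1 hn1)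
  have key : ∀ k, (k ≤ n → Q k = q k) ∧ (k + 1 ≤ n → Q (k + 1) = q (k + 1)) := by
    intro k
    induction k with
    | zero => exact ⟨fun _ => by rw [hQ0, hq0], fun h => by rw [zero_add, hQ1, hq1 (by omega)]⟩
    | succ k ih =>
      refine ⟨ih.2, fun hk => ?_⟩
      rw [show k + 1 + 1 = k + 2 by ring, hQrec k, ih.1 (by omega), ih.2 (by omega)]
      have hA1 : a' (k + 1) = A (k + 1) := by simp [ha']
      have hB1 : b' (k + 1) = B (k + 1) := by
        simp only [hb']
        rw [if_pos ⟨by omega, by omega⟩]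
      rw [hA1, hB1]
      have := hAB (k + 1) (by omega) (by omega)
      rw [show k + 1 - 1 = k by omega] at this
      exact this.symm
  exact fun k hk => (key k).1 hk

/-- **The quasi-orthogonal polynomial is a member of a modified recurrence**: for the recurrence `(a, b, q)`, `n` and real `c`, there is a recurrence `(A, B, Q)` with the SAME `B = b`, `Q_k = q_k`
for `k ≤ n + 1`, and `Q_{n+2} = q_{n+2} − c q_{n+1}` (namely `A_{n+1} = a_{n+1} + c`). [M. Riesz 1923; Chihara I Ex. 5.4; this file, §1060] -/
theorem quasiOrthogonal_recurrence {q : ℕ → ℝ[X]} {a b : ℕ → ℝ} (hq0 : q 0 = 1) (hq1 : q 1 = Polynomial.X - C (a 0))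
    (hrec : ∀ n, q (n + 2) = (Polynomial.X - C (a (n + 1))) * q (n + 1) - C (b (n + 1)) * q n) (n : ℕ) (c : ℝ) :
    ∃ (A B : ℕ → ℝ) (Q : ℕ → ℝ[X]), Q 0 = 1 ∧ Q 1 = Polynomial.X - C (A 0) ∧
      (∀ k, Q (k + 2) = (Polynomial.X - C (A (k + 1))) * Q (k + 1) - C (B (k + 1)) * Q k) ∧ (∀ j, B j = b j) ∧
      (∀ k, k ≤ n + 1 → Q k = q k) ∧ Q (n + 2) = q (n + 2) - C c * q (n + 1) := by
  obtain ⟨A, B, Q, hQ0, hQ1, hQrec, hBj, hBN, hagree, htop⟩ := recurrence_modify_top hq0 hq1 hrec n (a (n + 1) + c) (b (n + 1))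
  refine ⟨A, B, Q, hQ0, hQ1, hQrec, fun j => ?_, hagree, ?_⟩
  · by_cases hj : j = n + 1
    · rw [hj, hBN]
    · exact hBj j hj
  · rw [htop, hrec n, C_add]
    ring

/-- **ZEROS OF THE QUASI-ORTHOGONAL POLYNOMIAL**: for a positive recurrence and any real `c`, `q_{n+2} − c q_{n+1} = ∏_k (X − y_k)` with `y_0 < ⋯ < y_{n+1}` real and simple, interlaced by the
zeros `z_0 < ⋯ < z_n` of `q_{n+1}`: `y_k < z_k < y_{k+1}`. [M. Riesz 1923; Shohat 1937 §2; Chihara I Ex. 5.5, II Thm 5.2; this file, §1060] -/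
theorem quasiOrthogonal_zeros_interlace {q : ℕ → ℝ[X]} {a b : ℕ → ℝ} (hq0 : q 0 = 1) (hq1 : q 1 = Polynomial.X - C (a 0))
    (hrec : ∀ n, q (n + 2) = (Polynomial.X - C (a (n + 1))) * q (n + 1) - C (b (n + 1)) * q n) (hb : ∀ j, 0 < b j) (n : ℕ) (c : ℝ) :
    ∃ (z : Fin (n + 1) → ℝ) (y : Fin (n + 2) → ℝ), StrictMono z ∧ StrictMono y ∧ q (n + 1) = ∏ k, (Polynomial.X - C (z k)) ∧
      q (n + 2) - C c * q (n + 1) = ∏ k, (Polynomial.X - C (y k)) ∧ ∀ k : Fin (n + 1), y k.castSucc < z k ∧ z k < y k.succ := by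
  obtain ⟨A, B, Q, hQ0, hQ1, hQrec, hB, hagree, htop⟩ := quasiOrthogonal_recurrence hq0 hq1 hrec n c
  have hBpos : ∀ j, 0 < B j := fun j => by rw [hB j]; exact hb j
  obtain ⟨z, y, hz, hy, hzq, hyq, hint⟩ := recurrence_zeros_interlace hQ0 hQ1 hQrec hBpos n
  exact ⟨z, y, hz, hy, by rw [← hagree (n + 1) le_rfl, hzq], by rw [← htop, hyq], hint⟩

/-- **A zero at a prescribed point**: if `q_{n+1}(ξ) ≠ 0`, then with `c = q_{n+2}(ξ) ∕ q_{n+1}(ξ)` the quasi-orthogonal polynomial `q_{n+2} − c q_{n+1} = ∏_k (X − y_k)` has `y_i = ξ` for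
some `i`, with `y` strictly increasing and interlaced by the zeros of `q_{n+1}`. [Shohat 1937 §3; Szegő §3.411; Akhiezer I §4; this file, §1060] -/
theorem quasiOrthogonal_through {q : ℕ → ℝ[X]} {a b : ℕ → ℝ} (hq0 : q 0 = 1) (hq1 : q 1 = Polynomial.X - C (a 0))
    (hrec : ∀ n, q (n + 2) = (Polynomial.X - C (a (n + 1))) * q (n + 1) - C (b (n + 1)) * q n) (hb : ∀ j, 0 < b j) (n : ℕ) {ξ : ℝ}
    (hξ : (q (n + 1)).eval ξ ≠ 0) :
    ∃ (z : Fin (n + 1) → ℝ) (y : Fin (n + 2) → ℝ) (i : Fin (n + 2)), StrictMono z ∧ StrictMono y ∧ y i = ξ ∧ q (n + 1) = ∏ k, (Polynomial.X - C (z k)) ∧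
      q (n + 2) - C ((q (n + 2)).eval ξ / (q (n + 1)).eval ξ) * q (n + 1) = ∏ k, (Polynomial.X - C (y k)) ∧
      ∀ k : Fin (n + 1), y k.castSucc < z k ∧ z k < y k.succ := by
  obtain ⟨z, y, hz, hy, hzq, hyq, hint⟩ := quasiOrthogonal_zeros_interlace hq0 hq1 hrec hb n ((q (n + 2)).eval ξ / (q (n + 1)).eval ξ)
  have h0 : (∏ k, (Polynomial.X - C (y k))).eval ξ = 0 := by
    rw [← hyq, eval_sub, eval_mul, eval_C, div_mul_cancel₀ _ hξ, sub_self]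
  rw [eval_prod, Finset.prod_eq_zero_iff] at h0
  obtain ⟨i, -, hi⟩ := h0
  rw [eval_sub, eval_X, eval_C, sub_eq_zero] at hi
  exact ⟨z, y, i, hz, hy, hi.symm, hzq, hyq, hint⟩

/-- **SHOHAT'S THEOREM (exactness of the quasi-Gauss rule).**  If `q_{n+1}`, `q_{n+2}` are `(ν, w)`-orthogonal to all lower degrees and `q_{n+2} − c q_{n+1} = ∏_k (X − y_k)` with distinct `y_k`,
then the rule on the `y_k` with Christoffel weights `λ_k = Σ_l ν_l ℓ_k(w_l)` is exact in degree `≤ 2n + 2`. [Shohat 1937 Thm I; Chihara II Thm 5.1; this file, §1060] -/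
theorem quasi_gauss_exact {N n : ℕ} {ν w : Fin N → ℝ} {q : ℕ → ℝ[X]}
    (horth1 : ∀ G : ℝ[X], G.natDegree < n + 1 → ∑ l, ν l * (q (n + 1) * G).eval (w l) = 0)
    (horth2 : ∀ G : ℝ[X], G.natDegree < n + 2 → ∑ l, ν l * (q (n + 2) * G).eval (w l) = 0) {c : ℝ} {y : Fin (n + 2) → ℝ} (hy : Function.Injective y)
    (hyq : q (n + 2) - C c * q (n + 1) = ∏ k, (Polynomial.X - C (y k))) {μ : Fin (n + 2) → ℝ} (hμ : ∀ k, μ k = ∑ l, ν l * (Lagrange.basis Finset.univ y k).eval (w l))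
    {F : ℝ[X]} (hF : F.natDegree ≤ 2 * n + 2) :
    ∑ j, μ j * F.eval (y j) = ∑ l, ν l * F.eval (w l) := by
  refine sum_mul_eval_eq_of_orthogonal_lt (t := n + 1) hy (fun G hG => ?_) hμ (by omega)
  rw [← hyq]
  have hl : ∀ l, ν l * ((q (n + 2) - C c * q (n + 1)) * G).eval (w l) = ν l * (q (n + 2) * G).eval (w l) - c * (ν l * (q (n + 1) * G).eval (w l)) := fun l => by
    simp only [sub_mul, mul_assoc, eval_sub, eval_mul, eval_C]
    ring
  rw [Finset.sum_congr rfl fun l _ => hl l, Finset.sum_sub_distrib, ← Finset.mul_sum, horth2 G (by omega), horth1 G hG, mul_zero, sub_zero]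

/-- **THE POSITIVE RULE THROUGH A PRESCRIBED NODE.**  Let `ν_l > 0` on `N` distinct nodes `w_l`, `n + 2 ≤ N`; let `(a, b, q)` be a positive recurrence with `q_{n+1}`, `q_{n+2}` orthogonal for
`(ν, w)` to all lower degrees; and let `q_{n+1}(ξ) ≠ 0`.  Then there are nodes `y_0 < ⋯ < y_{n+1}` with `y_i = ξ` and weights `λ_k > 0` such that `Σ_k λ_k y_k^p = Σ_l ν_l w_l^p` for all
`p ≤ 2n + 2`. [Shohat 1937 Thm I–II; Chihara II Thm 5.3; Krein–Nudel'man III §2; this file, §1060] -/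
theorem quasi_gauss_rule_through {N n : ℕ} {ν w : Fin N → ℝ} (hν : ∀ l, 0 < ν l) (hw : Function.Injective w) (hN : n + 2 ≤ N) {q : ℕ → ℝ[X]} {a b : ℕ → ℝ}
    (hq0 : q 0 = 1) (hq1 : q 1 = Polynomial.X - C (a 0)) (hrec : ∀ n, q (n + 2) = (Polynomial.X - C (a (n + 1))) * q (n + 1) - C (b (n + 1)) * q n) (hb : ∀ j, 0 < b j)
    (horth1 : ∀ G : ℝ[X], G.natDegree < n + 1 → ∑ l, ν l * (q (n + 1) * G).eval (w l) = 0)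
    (horth2 : ∀ G : ℝ[X], G.natDegree < n + 2 → ∑ l, ν l * (q (n + 2) * G).eval (w l) = 0) {ξ : ℝ} (hξ : (q (n + 1)).eval ξ ≠ 0) :
    ∃ (y μ : Fin (n + 2) → ℝ) (i : Fin (n + 2)), StrictMono y ∧ y i = ξ ∧ (∀ k, 0 < μ k) ∧ ∀ p, p ≤ 2 * n + 2 → ∑ k, μ k * y k ^ p = ∑ l, ν l * w l ^ p := by
  obtain ⟨z, y, i, -, hy, hyi, -, hyq, -⟩ := quasiOrthogonal_through hq0 hq1 hrec hb n hξ
  set μ : Fin (n + 2) → ℝ := fun k => ∑ l, ν l * (Lagrange.basis Finset.univ y k).eval (w l) with hμ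
  have hmom : ∀ p, p ≤ 2 * n + 2 → ∑ k, μ k * y k ^ p = ∑ l, ν l * w l ^ p := fun p hp => by
    have h := quasi_gauss_exact horth1 horth2 hy.injective hyq (μ := μ) (fun k => rfl) (F := Polynomial.X ^ p) (by rw [natDegree_X_pow]; exact hp)
    simpa only [eval_pow, eval_X] using h
  refine ⟨y, μ, i, hy, hyi, ?_, hmom⟩
  exact gauss_weight_pos (t := n + 1) hy.injective hν hw (by omega) (fun p hp => hmom p (by omega))

/-- **CHEBYSHEV–MARKOV–STIELTJES AT AN ARBITRARY REAL POINT.**  Let `ν_l > 0` on `N` distinct nodes `w_l` and `n + 2 < N`.  For EVERY real `ξ` there is a positive rule with `t + 1` nodes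
`x_0 < ⋯ < x_t` (`t = n` or `t = n + 1`), one of which is `x_i = ξ`, exact in degree `≤ 2t`, and then
`Σ_{j<i} λ_j ≤ ν{w < ξ} ≤ ν{w ≤ ξ} ≤ Σ_{j≤i} λ_j` (N271 applied to this rule).  [Szegő §3.411; Akhiezer I §4 (canonical representations); Krein–Nudel'man III §2; Shohat 1937; this file, §1060] -/
theorem chebyshev_markov_stieltjes_through {N n : ℕ} {ν w : Fin N → ℝ} (hν : ∀ l, 0 < ν l) (hw : Function.Injective w) (hnN : n + 2 < N) (ξ : ℝ) :
    ∃ (t : ℕ) (μ x : Fin (t + 1) → ℝ) (i : Fin (t + 1)), n ≤ t ∧ t ≤ n + 1 ∧ StrictMono x ∧ x i = ξ ∧ (∀ j, 0 < μ j) ∧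
      (∀ p, p ≤ 2 * t → ∑ j, μ j * x j ^ p = ∑ l, ν l * w l ^ p) ∧
      ∑ j ∈ Finset.univ.filter (fun j => j < i), μ j ≤ ∑ l ∈ Finset.univ.filter (fun l => w l < ξ), ν l ∧
      ∑ l ∈ Finset.univ.filter (fun l => w l < ξ), ν l ≤ ∑ l ∈ Finset.univ.filter (fun l => w l ≤ ξ), ν l ∧
      ∑ l ∈ Finset.univ.filter (fun l => w l ≤ ξ), ν l ≤ ∑ j ∈ Finset.univ.filter (fun j => j ≤ i), μ j := by
  have hν' : ∀ l, 0 ≤ ν l := fun l => (hν l).le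
  -- the orthogonal polynomials up to degree `n + 2` and their global recurrence
  obtain ⟨q, hq0, hm, hd, horth, -⟩ := exists_orthogonal_system_lower hν hw hnN
  obtain ⟨a, b, Q, hQ0, hQ1, hQrec, hb, hagree⟩ := exists_positive_recurrence_of_orthogonal hν hw hnN hq0 hm hd horth
  have horthQ : ∀ k, k ≤ n + 2 → ∀ G : ℝ[X], G.natDegree < k → ∑ l, ν l * (Q k * G).eval (w l) = 0 := fun k hk G hG => by
    rw [hagree k hk]; exact horth k hk G hG
  by_cases hξ : (Q (n + 1)).eval ξ = 0
  · -- `ξ` is a Gauss node: the Gauss rule with `n + 1` nodes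
    obtain ⟨z, hz, hzr, -⟩ := recurrence_zeros hQ0 hQ1 hQrec hb n
    have hmd := recurrence_monic_natDegree hQ0 hQ1 hQrec (n + 1)
    have hprod : Q (n + 1) = ∏ k, (Polynomial.X - C (z k)) := eq_prod_X_sub_C_of_monic_of_roots hmd.1 hmd.2 hz.injective hzr
    have hroot : (∏ k, (Polynomial.X - C (z k))).eval ξ = 0 := by rw [← hprod]; exact hξ
    rw [eval_prod, Finset.prod_eq_zero_iff] at hroot
    obtain ⟨i, -, hi⟩ := hroot
    rw [eval_sub, eval_X, eval_C, sub_eq_zero] at hi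
    have horthz : ∀ G : ℝ[X], G.natDegree ≤ n → ∑ l, ν l * ((∏ j, (Polynomial.X - C (z j))) * G).eval (w l) = 0 := fun G hG => by
      rw [← hprod]; exact horthQ (n + 1) (by omega) G (by omega)
    set μ : Fin (n + 1) → ℝ := fun k => ∑ l, ν l * (Lagrange.basis Finset.univ z k).eval (w l) with hμ
    have hmom : ∀ p, p ≤ 2 * n + 1 → ∑ k, μ k * z k ^ p = ∑ l, ν l * w l ^ p := fun p hp => by
      have h := sum_mul_eval_eq_of_orthogonal hz.injective horthz (μ := μ) (fun k => rfl) (F := Polynomial.X ^ p) (by rw [natDegree_X_pow]; exact hp)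
      simpa only [eval_pow, eval_X] using h
    have hmom' : ∀ p, p ≤ 2 * n → ∑ k, μ k * z k ^ p = ∑ l, ν l * w l ^ p := fun p hp => hmom p (by omega)
    have hpos : ∀ k, 0 < μ k := gauss_weight_pos hz.injective hν hw (by omega) hmom'
    have hcms := chebyshev_markov_stieltjes hz hν' hmom' i
    rw [← hi] at hcms
    exact ⟨n, μ, z, i, le_rfl, by omega, hz, hi.symm, hpos, hmom', hcms⟩
  · -- the quasi-Gauss rule with `n + 2` nodes through `ξ`
    obtain ⟨y, μ, i, hy, hyi, hpos, hmom⟩ := quasi_gauss_rule_through hν hw (by omega) hQ0 hQ1 hQrec hb (horthQ (n + 1) (by omega)) (horthQ (n + 2) le_rfl) hξ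
    have hcms := chebyshev_markov_stieltjes hy hν' (t := n + 1) (fun p hp => hmom p (by omega)) i
    rw [hyi] at hcms
    exact ⟨n + 1, μ, y, i, by omega, le_rfl, hy, hyi, hpos, fun p hp => hmom p (by omega), hcms⟩

end Summit.Ventures.HSemireg.Wedge.HankelOuter
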